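import Mathlib
import Literature.NumberTheory.Automorphic.HilbertModularFormQExpansion
import Summits.Langlands.Langlands.Theorems.CapacityClassicalityHilbertIntegralOverconvergentIsCongruenceKoecherGlue
import Summits.Langlands.Langlands.Theorems.CapacityClassicalityHilbertIntegralOverconvergentIsCongruenceStubDualLatticeEquiv
import Summits.Langlands.Langlands.Theorems.CapacityClassicalityHilbertIntegralOverconvergentIsCongruenceStubPairingCubePoint

/-!
# Uniqueness of `q`-expansion coefficients on the tube domain (stub M-B2)

Stub M-B2 `stub_fourierCoeffAt_of_hasSum` of line Sketch-ideate-r1-k1 (section M, RESHAPE 9) for the crux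
`HilbertIntegralOverconvergentIsCongruence` (stmt-Langlands-8485): if on the height-`y` slice of `ℍ^{Hom(F,ℝ)}`
a function is the sum of a `q`-series over the dual lattice, `f(x+iy) = ∑_{ν ∈ 𝔡⁻¹} a_ν e^{2πi S(ν(x+iy))}`, with
`∑_ν |a_ν| e^{-2π⟨ν,y⟩} < ∞`, then its Fourier coefficients at height `y` (`HilbertModular.fourierCoeffAt`, the cube
integrals of Freitag, *Hilbert Modular Forms*, Ch. I Lemma 4.1) ARE the `a_ν`.  Proof: integrate termwise over the
cube (the `x`-sup-norm of the `ν`-th term is `|a_ν| e^{-2π⟨ν,y⟩} e^{2π⟨ν₀,y⟩}`, summable: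
`MeasureTheory.hasSum_integral_of_summable_integral_norm`), write the phases in cube coordinates
(`stub_pairing_cubePoint`: `S(ν(x+iy)) = n(ν)·x + i⟨ν,y⟩` with `n(ν) = (Tr(ν b_i))_i`, `stub_dualLatticeEquiv`:
`ν ↦ n(ν)` is a bijection `𝔡⁻¹ ≃ ℤ^ι`) and use the orthogonality of the characters `e^{2πi m·x}` on `[0,1]^ι`
(`qu_cube_orthogonality`, Fubini over the cube).
-/

set_option linter.dupNamespace false

noncomputable section

namespace Summit.Langlands.Langlands.Theorems.HilbertIntegralOverconvergentIsCongruence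

open MeasureTheory Complex NumberField
open Literature.NumberTheory.Automorphic Literature.NumberTheory.Automorphic.HilbertModular

/-! ## Orthogonality of characters on the unit cube -/

/-- One-dimensional orthogonality: `∫_0^1 e^{2πi m t} dt = [m = 0]` for `m ∈ ℤ`. -/
theorem qu_integral_cexp_int (m : ℤ) :
    ∫ t in Set.Icc (0 : ℝ) 1, cexp (2 * Real.pi * I * ((m : ℝ) * t : ℝ)) = if m = 0 then 1 else 0 := by
  rw [integral_Icc_eq_integral_Ioc, ← intervalIntegral.integral_of_le zero_le_one]
  split_ifs with hm
  · simp [hm]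
  · have hc : (2 * Real.pi * I * (m : ℂ)) ≠ 0 := by
      have hm' : (m : ℂ) ≠ 0 := by exact_mod_cast hm
      have hπ : (Real.pi : ℂ) ≠ 0 := by exact_mod_cast Real.pi_ne_zero
      simp [hm', hπ, I_ne_zero]
    have hfun : (fun t : ℝ ↦ cexp (2 * Real.pi * I * ((m : ℝ) * t : ℝ))) =
        fun t : ℝ ↦ cexp (2 * Real.pi * I * (m : ℂ) * t) := by
      funext t
      congr 1
      push_cast
      ring
    rw [hfun, integral_exp_mul_complex hc]
    have h1 : cexp (2 * Real.pi * I * (m : ℂ)) = 1 := by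
      rw [show 2 * Real.pi * I * (m : ℂ) = m * (2 * Real.pi * I) by ring]
      exact Complex.exp_int_mul_two_pi_mul_I m
    simp [h1]

/-- **Orthogonality of the characters `e^{2πi m·x}` on the unit cube**: `∫_{[0,1]^ι} e^{2πi m·x} dx = [m = 0]`
(Fubini, `MeasureTheory.integral_fintype_prod_eq_prod`). -/
theorem qu_cube_orthogonality {ι : Type} [Fintype ι] (m : ι → ℤ) :
    ∫ x in Set.Icc (0 : ι → ℝ) 1, cexp (2 * Real.pi * I * (∑ i, (m i : ℝ) * x i : ℝ)) =
      if m = 0 then 1 else 0 := by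
  have hprod : ∀ x : ι → ℝ, cexp (2 * Real.pi * I * (∑ i, (m i : ℝ) * x i : ℝ)) =
      ∏ i, cexp (2 * Real.pi * I * ((m i : ℝ) * x i : ℝ)) := by
    intro x
    rw [← Complex.exp_sum]
    congr 1
    push_cast
    rw [Finset.mul_sum]
  simp_rw [hprod]
  have hmeas : (volume : Measure (ι → ℝ)).restrict (Set.Icc 0 1) =
      Measure.pi fun _ : ι ↦ (volume : Measure ℝ).restrict (Set.Icc 0 1) := by
    rw [volume_pi, ← Measure.restrict_pi_pi, Set.pi_univ_Icc]
    rfl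
  rw [hmeas, integral_fintype_prod_eq_prod (fun i (t : ℝ) ↦ cexp (2 * Real.pi * I * ((m i : ℝ) * t : ℝ)))]
  simp_rw [qu_integral_cexp_int]
  split_ifs with hm
  · simp [hm]
  · obtain ⟨i, hi⟩ : ∃ i, m i ≠ 0 := by
      by_contra h
      push Not at h
      exact hm (funext h)
    exact Finset.prod_eq_zero (Finset.mem_univ i) (if_neg hi)

/-! ## The uniqueness theorem -/

/-- **Stub M-B2 — `stub_fourierCoeffAt_of_hasSum`.** Uniqueness of `q`-expansion coefficients: if
`f(x + iy) = ∑_{ν ∈ 𝔡⁻¹} a_ν e^{2πi S(ν(x+iy))}` on the whole height-`y` slice with `∑ |a_ν| e^{-2π⟨ν,y⟩} < ∞`, then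
`a_ν(y) = a_ν` (termwise integration over the cube and orthogonality of the characters `e^{2πi n·x}` on `[0,1]^ι`).
[cite: Freitag1990, Ch. I Lemma 4.1] -/
theorem stub_fourierCoeffAt_of_hasSum (F : Type) [Field F] [NumberField F] [NumberField.IsTotallyReal F]
    (f : Point F → ℂ) (a : F → ℂ) (y : (F →+* ℝ) → ℝ)
    (hsum : ∀ x : Coord F, HasSum (fun ν : {ν : F | ∀ b : 𝓞 F, ∃ n : ℤ, Algebra.trace ℚ F (ν * b) = n} ↦
      a ν * cexp (2 * Real.pi * I * pairing (ν : F) (cubePoint x y))) (f (cubePoint x y)))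
    (habs : Summable (fun ν : {ν : F | ∀ b : 𝓞 F, ∃ n : ℤ, Algebra.trace ℚ F (ν * b) = n} ↦
      ‖a ν‖ * Real.exp (-(2 * Real.pi * ∑ σ : F →+* ℝ, σ (ν : F) * y σ))))
    (ν : F) (hν : ∀ b : 𝓞 F, ∃ n : ℤ, Algebra.trace ℚ F (ν * b) = n) :
    fourierCoeffAt f ν y = a ν := by
  classical
  set D : Set F := {ν : F | ∀ b : 𝓞 F, ∃ n : ℤ, Algebra.trace ℚ F (ν * b) = n} with hDdef
  obtain ⟨e, he⟩ := stub_dualLatticeEquiv F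
  haveI : Countable D := Countable.of_equiv _ e.symm
  -- heights pairing
  set B : F → ℝ := fun μ ↦ ∑ σ : F →+* ℝ, σ μ * y σ with hBdef
  -- the phase of a `q`-monomial in cube coordinates
  have hphase : ∀ (μ : D) (x : Coord F), cexp (2 * Real.pi * I * pairing (μ : F) (cubePoint x y)) =
      cexp (2 * Real.pi * I * (∑ i, (e μ i : ℝ) * x i : ℝ)) * (Real.exp (-(2 * Real.pi * B μ)) : ℂ) := by
    intro μ x
    rw [stub_pairing_cubePoint F (μ : F) (e μ) (he μ) x y, Complex.ofReal_exp, ← Complex.exp_add]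
    congr 1
    simp only [hBdef]
    push_cast
    ring_nf
    rw [Complex.I_sq]
    ring
  have hν₀ : (⟨ν, hν⟩ : D) ∈ (Set.univ : Set D) := Set.mem_univ _
  set ν₀ : D := ⟨ν, hν⟩ with hν₀def
  -- the terms after multiplication by the conjugate character of `ν`
  set G : D → Coord F → ℂ := fun μ x ↦
    a μ * cexp (2 * Real.pi * I * pairing (μ : F) (cubePoint x y)) *
      cexp (-(2 * Real.pi * I * pairing ν (cubePoint x y))) with hGdef
  have hG : ∀ (μ : D) (x : Coord F), G μ x =
      (a μ * (Real.exp (-(2 * Real.pi * B μ)) : ℂ) * (Real.exp (2 * Real.pi * B ν) : ℂ)) *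
        cexp (2 * Real.pi * I * (∑ i, ((e μ - e ν₀) i : ℝ) * x i : ℝ)) := by
    intro μ x
    have h0 : cexp (-(2 * Real.pi * I * pairing ν (cubePoint x y))) =
        cexp (-(2 * Real.pi * I * (∑ i, (e ν₀ i : ℝ) * x i : ℝ))) * (Real.exp (2 * Real.pi * B ν) : ℂ) := by
      have hpair : pairing ν (cubePoint x y) =
          ((∑ i, (e ν₀ i : ℝ) * x i : ℝ) : ℂ) + ((∑ σ : F →+* ℝ, σ ν * y σ : ℝ) : ℂ) * I :=
        stub_pairing_cubePoint F ν (e ν₀) (he ν₀) x y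
      rw [Complex.ofReal_exp, ← Complex.exp_add, hpair]
      congr 1
      simp only [hBdef]
      push_cast
      ring_nf
      rw [Complex.I_sq]
      ring
    rw [hGdef]
    simp only
    rw [hphase μ x, h0]
    have hsplit : cexp (2 * Real.pi * I * (∑ i, ((e μ - e ν₀) i : ℝ) * x i : ℝ)) =
        cexp (2 * Real.pi * I * (∑ i, (e μ i : ℝ) * x i : ℝ)) *
          cexp (-(2 * Real.pi * I * (∑ i, (e ν₀ i : ℝ) * x i : ℝ))) := by
      rw [← Complex.exp_add]
      congr 1
      simp only [Pi.sub_apply, Int.cast_sub, sub_mul, Finset.sum_sub_distrib]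
      push_cast
      ring
    rw [hsplit]
    ring
  -- norms of the terms are constant in `x`
  have hGnorm : ∀ (μ : D) (x : Coord F), ‖G μ x‖ =
      ‖a μ‖ * Real.exp (-(2 * Real.pi * B μ)) * Real.exp (2 * Real.pi * B ν) := by
    intro μ x
    rw [hG μ x, norm_mul, Complex.norm_exp]
    have hre : (2 * Real.pi * I * ((∑ i, ((e μ - e ν₀) i : ℝ) * x i : ℝ) : ℂ)).re = 0 := by
      simp [Complex.mul_re]
    rw [hre, Real.exp_zero, mul_one, norm_mul, norm_mul, Complex.norm_real, Complex.norm_real,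
      Real.norm_of_nonneg (Real.exp_nonneg _), Real.norm_of_nonneg (Real.exp_nonneg _)]
  -- continuity / integrability of the terms on the cube
  have hGcont : ∀ μ : D, Continuous (G μ) := by
    intro μ
    have hc : Continuous fun x : Coord F ↦ cubePoint x y := koe_continuous_cubePoint y
    have hp : ∀ μ' : F, Continuous fun x : Coord F ↦ pairing μ' (cubePoint x y) := fun μ' ↦ by
      simp only [pairing]
      fun_prop
    simp only [hGdef]
    fun_prop
  have hGint : ∀ μ : D, Integrable (G μ) ((volume : Measure (Coord F)).restrict (Set.Icc 0 1)) := fun μ ↦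
    (hGcont μ).continuousOn.integrableOn_compact isCompact_Icc
  -- summability of the integrals of the norms
  have hvol : (volume : Measure (Coord F)).real (Set.Icc 0 1) = 1 := by
    rw [measureReal_def, Real.volume_Icc_pi_toReal zero_le_one]
    simp
  have hnormint : ∀ μ : D, ∫ x in Set.Icc (0 : Coord F) 1, ‖G μ x‖ =
      ‖a μ‖ * Real.exp (-(2 * Real.pi * B μ)) * Real.exp (2 * Real.pi * B ν) := by
    intro μ
    simp_rw [hGnorm μ]
    rw [setIntegral_const, hvol, one_smul]
  have hsumnorm : Summable fun μ : D ↦ ∫ x in Set.Icc (0 : Coord F) 1, ‖G μ x‖ := by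
    simp_rw [hnormint]
    exact (habs.mul_right (Real.exp (2 * Real.pi * B ν))).congr fun μ ↦ by simp [hBdef]
  -- termwise integration
  have hswap := hasSum_integral_of_summable_integral_norm hGint hsumnorm
  -- the integral of the sum is the Fourier coefficient
  have hlhs : ∫ x in Set.Icc (0 : Coord F) 1, ∑' μ : D, G μ x = fourierCoeffAt f ν y := by
    refine setIntegral_congr_fun measurableSet_Icc fun x _ ↦ ?_
    have h := (hsum x).mul_right (cexp (-(2 * Real.pi * I * pairing ν (cubePoint x y))))
    exact h.tsum_eq
  -- the termwise integrals: orthogonality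
  have hterm : ∀ μ : D, ∫ x in Set.Icc (0 : Coord F) 1, G μ x = if μ = ν₀ then a ν else 0 := by
    intro μ
    simp_rw [hG μ]
    rw [integral_const_mul, qu_cube_orthogonality]
    by_cases hμ : μ = ν₀
    · subst hμ
      simp only [sub_self, ↓reduceIte, mul_one]
      rw [show ((ν₀ : D) : F) = ν from rfl, mul_assoc, ← Complex.ofReal_mul, ← Real.exp_add]
      simp
    · have hne : e μ - e ν₀ ≠ 0 := fun h ↦ hμ (e.injective (sub_eq_zero.1 h))
      simp [hne, hμ]
  rw [hlhs] at hswap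
  simp_rw [hterm] at hswap
  have hsingle : HasSum (fun μ : D ↦ if μ = ν₀ then a ν else 0) (a ν) := by
    simpa using hasSum_ite_eq ν₀ (a ν)
  exact hswap.unique hsingle

end Summit.Langlands.Langlands.Theorems.HilbertIntegralOverconvergentIsCongruence
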